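import Literature.Probability.RandomPlanarGeometry.ImaginaryGeometryRegular
import Literature.Probability.RandomPlanarGeometry.ImaginaryGeometryPointFlow
import Literature.Probability.Process.OptionalStopping
import Literature.Probability.Process.ItoIntegralStopping
import Literature.Probability.Process.ItoIntegralLocality
import Literature.Probability.Process.BoundedItoIntegral
import HarnessLib

/-!
# SLE(κ, ρ) point flow for Miller–Sheffield's Theorem 2.4 (⇒): localisation, stopped processes, bounds, identities

Third file of the almost-sure form of Miller–Sheffield's Theorem 2.4, forward direction
(J. Miller, S. Sheffield, *Imaginary geometry I*, PTRF 164 (2016), §2.3; proof: "applying Itô's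
formula (away from times when `W_t` collides with a force point)"), after
`ImaginaryGeometryRegular.lean` (regular version `(W', J)`, good paths, progressive flows) and
`ImaginaryGeometryPointFlow.lean` (deterministic identities). For a regular version of an
SLE(κ, ρ) driving pair, a point `z ∈ ℍ` and `n : ℕ` we set up the localised Itô calculus exactly
as the tree does for SLE_κ (`SLEPointFlow*.lean`), but in the raw filtration with only
a.s.-continuous paths, hence with OPTIONAL times and clamped progressive versions:

* `SLEKappaRho.igLocTime W' J z n` — the localising optional time `ρₙ = Hₙ ∧ Sₙ ∧ Iₙ ∧ (n+1)`:
  rational debuts (`ratExceed`) of `{y_t < im z/(n+2)}`, `{|W'_t| > n+1}`, `{∫₀ᵗ J > n+1}`; on a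
  good path, up to `ρₙ`: `y ≥ im z/(n+2)` (so `ρₙ < T_z`), `|W| ≤ n+1`, `∫₀ J ≤ n+1`,
  `|x| ≤ C_x`, `0 ≤ Z' ≤ 3(n+1)`;
* the stopped, clamped, progressively measurable processes `igX` (`x`), `igY` (`y`), `igQ = X²+Y²`,
  `igInvY = 1/Y`, `igZp` (`Z' = W - O`), the truncated coefficient processes of their calculus
  and the time integral `igA` (`arg g_t'(z)`), with bounds valid for EVERY sample;
* **identification on good paths** (hence almost surely, at all times): with the stopped clock
  `u = t ∧ ρₙ`, `igX_t = x_u`, `igY_t = y_u`, `igZp_t = Z'_u = W_u - O_u`, and the integrated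
  equations `x_u = re z + ∫₀ᵗ 𝟙_{s≤ρₙ}(2X/Q - ρJ) ds - √κ B_u` (Loewner + `W = √κB + ρ∫J`),
  `1/Y_t = 1/im z + ∫₀ᵗ 𝟙 2/(YQ) ds`, `Z'_u = ∫₀ᵗ 𝟙 (ρ+2)J ds + √κ B_u`,
  `arg g_u'(z) = ∫₀ᵗ 𝟙 4XY/Q² ds`.

The Itô-process statements and Itô's formula are the next file (`ImaginaryGeometryIto.lean`).
No named fact is introduced.

## References

* J. Miller, S. Sheffield, *Imaginary geometry I*, PTRF 164 (2016), §2.3 Thm. 2.4 (proof).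
* S. Rohde, O. Schramm, *Basic properties of SLE*, Ann. of Math. 161 (2005), proof of Lemma 6.3
  (the localisation `tₙ ↑ τ(z)` of the point flow).
* D. Revuz, M. Yor, *Continuous Martingales and Brownian Motion* (1999), Ch. I §4, Ch. IV §§1–3.
-/

noncomputable section

open Set Filter MeasureTheory Complex
open _root_.Topology
open scoped NNReal
open Literature.Analysis.FunctionSpaces Literature.Probability.Process

namespace Literature.Probability.RandomPlanarGeometry

namespace SLEKappaRho

/-! ### Constants, the localising optional time -/

/-- The level `im z/(n+2)` below which `y` is not allowed to drop before `ρₙ`. [folklore] -/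
def igLevel (z : ℂ) (n : ℕ) : ℝ := z.im / (n + 2)

/-- The bound `C_x = |re z| + (n+1) + (n+1)(n+2)/im z` for `|x|` on `[0, ρₙ]`. [folklore] -/
def igCx (z : ℂ) (n : ℕ) : ℝ := |z.re| + (n + 1) + (n + 1) * ((n + 2) / z.im)

/-- Two-sided clamp `max (-C) (min C v)`. [folklore] -/
def igClamp (C v : ℝ) : ℝ := max (-C) (min C v)

variable (W' J : ℝ≥0 → (ℝ≥0 → ℝ) → ℝ) (z : ℂ) (n : ℕ)

/-- **The localising optional time `ρₙ = Hₙ ∧ Sₙ ∧ Iₙ ∧ (n+1)`**: `Hₙ` the rational debut of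
`{y < im z/(n+2)}` for the progressive frozen imaginary part `yReg W' z`, `Sₙ` that of
`{|W'| > n+1}`, `Iₙ` that of `{∫₀ J > n+1}` (all `ratExceed`, optional for the raw Brownian
filtration), capped at the constant `n+1`. Rohde–Schramm's "increasing sequence of stopping times
`tₙ < τ(ẑ)`" (proof of Lemma 6.3) in the a.s.-continuous setting of SLE(κ, ρ).
[cite: RohdeSchramm2005, Lemma 6.3 (proof)] -/
def igLocTime (ω : ℝ≥0 → ℝ) : WithTop ℝ≥0 :=
  min (ratExceed (fun t ω ↦ -Loewner.yReg W' z t ω) (-igLevel z n) ω)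
    (min (ratExceed (fun t ω ↦ |W' t ω|) (n + 1) ω)
      (min (ratExceed (fun t ω ↦ timeIntegral J t ω) (n + 1) ω)
        (((n : ℝ≥0) + 1 : ℝ≥0) : WithTop ℝ≥0)))

variable {W' J z n}

/-- The level is positive and below `im z` (`im z > 0`). [folklore] -/
theorem igLevel_pos_lt {z : ℂ} (hz : 0 < z.im) (n : ℕ) : 0 < igLevel z n ∧ igLevel z n < z.im := by
  refine ⟨by unfold igLevel; positivity, ?_⟩
  unfold igLevel
  rw [div_lt_iff₀ (by positivity)]
  nlinarith

/-- `(igLevel)⁻¹ = (n+2)/im z`. [folklore] -/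
theorem inv_igLevel (z : ℂ) (n : ℕ) : (igLevel z n)⁻¹ = (n + 2) / z.im := by
  rw [igLevel, inv_div]

/-- `0 ≤ C_x`. [folklore] -/
theorem igCx_nonneg {z : ℂ} (hz : 0 < z.im) (n : ℕ) : 0 ≤ igCx z n := by
  unfold igCx; positivity

/-- `|clamp C v| ≤ C` for `C ≥ 0`. [folklore] -/
theorem abs_igClamp_le {C : ℝ} (hC : 0 ≤ C) (v : ℝ) : |igClamp C v| ≤ C := by
  unfold igClamp
  rw [abs_le]
  exact ⟨le_max_left _ _, max_le (by linarith) (min_le_left _ _)⟩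

/-- The clamp is inactive on `[-C, C]`. [folklore] -/
theorem igClamp_of_abs_le {C v : ℝ} (h : |v| ≤ C) : igClamp C v = v := by
  unfold igClamp
  rw [abs_le] at h
  rw [min_eq_right h.2, max_eq_right h.1]

/-- The clamp is continuous. [folklore] -/
theorem continuous_igClamp (C : ℝ) : Continuous (igClamp C) :=
  continuous_const.max (continuous_const.min continuous_id)

/-- `ρₙ ≤ n + 1`. [folklore] -/
theorem igLocTime_le (ω : ℝ≥0 → ℝ) :
    igLocTime W' J z n ω ≤ (((n : ℝ≥0) + 1 : ℝ≥0) : WithTop ℝ≥0) :=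
  (min_le_right _ _).trans ((min_le_right _ _).trans (min_le_right _ _))

/-- `ρₙ < ⊤`. [folklore] -/
theorem igLocTime_ne_top (ω : ℝ≥0 → ℝ) : igLocTime W' J z n ω ≠ ⊤ :=
  ne_top_of_le_ne_top WithTop.coe_ne_top (igLocTime_le ω)

/-- The stopped clock `t ∧ ρₙ` is `≤ ρₙ`. [folklore] -/
theorem igClock_le (t : ℝ≥0) (ω : ℝ≥0 → ℝ) :
    (((min (t : WithTop ℝ≥0) (igLocTime W' J z n ω)).untopA : ℝ≥0) : WithTop ℝ≥0) ≤
      igLocTime W' J z n ω :=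
  coe_untopA_min_le t _

/-- The stopped clock is `≤ n + 1`. [folklore] -/
theorem igClock_le_nat (t : ℝ≥0) (ω : ℝ≥0 → ℝ) :
    ((min (t : WithTop ℝ≥0) (igLocTime W' J z n ω)).untopA : ℝ) ≤ n + 1 := by
  have h := (igClock_le (W' := W') (J := J) (z := z) (n := n) t ω).trans (igLocTime_le ω)
  exact_mod_cast (WithTop.coe_le_coe.1 h)

/-- The stopped clock of a time `v ≤ ρₙ` is `v`. [folklore] -/
theorem igClock_eq_of_le {ω : ℝ≥0 → ℝ} {v : ℝ≥0} (hv : (v : WithTop ℝ≥0) ≤ igLocTime W' J z n ω) :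
    ((min (v : WithTop ℝ≥0) (igLocTime W' J z n ω)).untopA : ℝ≥0) = v := by
  rw [min_eq_left hv]; rfl

/-- Real times in `[0, u]`, `↑u ≤ ρₙ`, read in `ℝ≥0`, are `≤ ρₙ`. [folklore] -/
theorem toNNReal_le_igLocTime_of_mem {ω : ℝ≥0 → ℝ} {u : ℝ≥0}
    (hu : (u : WithTop ℝ≥0) ≤ igLocTime W' J z n ω) {s : ℝ} (hs : s ∈ Icc (0 : ℝ) u) :
    ((s.toNNReal : ℝ≥0) : WithTop ℝ≥0) ≤ igLocTime W' J z n ω :=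
  (WithTop.coe_le_coe.2 (Real.toNNReal_le_iff_le_coe.2 hs.2)).trans hu

section Optional

variable {κ : ℝ≥0} {ρ : ℝ} {W : ℝ≥0 → (ℝ≥0 → ℝ) → ℝ}

/-- **`ρₙ` is an optional time** of the raw Brownian filtration (rational debuts of adapted
processes, `isOptionalTime_ratExceed`, and a constant). [cite: Legall2016, Prop. 3.9] -/
theorem isOptionalTime_igLocTime (h : RegularPair κ ρ W W' J) (hz : 0 < z.im) (n : ℕ) :
    IsOptionalTime brownianFiltration (igLocTime W' J z n) := by
  have h1 : Adapted brownianFiltration fun t ω ↦ -Loewner.yReg W' z t ω := fun t ↦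
    ((h.isStronglyProgressive_yReg hz).stronglyAdapted t).measurable.neg
  have h2 : Adapted brownianFiltration fun t ω ↦ |W' t ω| := fun t ↦
    continuous_abs.measurable.comp (h.adapted t)
  have h3 : Adapted brownianFiltration fun t ω ↦ timeIntegral J t ω := fun t ↦
    adapted_timeIntegral h.progressive t
  exact (isOptionalTime_ratExceed h1 _).min ((isOptionalTime_ratExceed h2 _).min
    ((isOptionalTime_ratExceed h3 _).min (isOptionalTime_const _ _)))

end Optional

/-! ### Good paths up to `ρₙ` -/

namespace GoodPath

variable {κ : ℝ≥0} {ρ : ℝ} {O W : ℝ≥0 → (ℝ≥0 → ℝ) → ℝ} {ω : ℝ≥0 → ℝ}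

/-- **On `[0, ρₙ]` the frozen imaginary part is at least `im z/(n+2)`** (good path): the path
of `yReg W' z = y` is continuous and starts at `im z` above the level, and `ρₙ ≤ Hₙ`
(`le_of_le_ratExceed`). [folklore] -/
theorem level_le_imFlowStop (h : GoodPath κ ρ O W W' J ω) (hz : 0 < z.im) {s : ℝ≥0}
    (hs : (s : WithTop ℝ≥0) ≤ igLocTime W' J z n ω) :
    igLevel z n ≤ Loewner.imFlowStop (fun r ↦ W r ω) z s := by
  have hpath : (fun t ↦ -Loewner.yReg W' z t ω) = fun t ↦ -Loewner.imFlowStop (fun r ↦ W r ω) z t :=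
    funext fun t ↦ by rw [h.yReg_eq hz]
  have hc : Continuous fun t ↦ (fun t ω ↦ -Loewner.yReg W' z t ω) t ω := by
    show Continuous fun t ↦ -Loewner.yReg W' z t ω
    rw [hpath]
    exact (Loewner.continuous_imFlowStop h.continuous_snd hz).neg
  have h0 : (fun t ω ↦ -Loewner.yReg W' z t ω) 0 ω ≤ -igLevel z n := by
    show -Loewner.yReg W' z 0 ω ≤ -igLevel z n
    rw [h.yReg_eq hz, Loewner.imFlowStop_zero h.continuous_snd hz]
    exact neg_le_neg (igLevel_pos_lt hz n).2.le
  have hle := le_of_le_ratExceed hc h0 (hs.trans (min_le_left _ _))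
  change -Loewner.yReg W' z s ω ≤ -igLevel z n at hle
  rw [h.yReg_eq hz] at hle
  linarith

/-- **Times up to `ρₙ` are before the swallowing time** (good path): `y_s ≥ im z/(n+2) > 0`.
[cite: RohdeSchramm2005, Lemma 6.3 (proof)] -/
theorem coe_lt_swallowingTime (h : GoodPath κ ρ O W W' J ω) (hz : 0 < z.im) {s : ℝ≥0}
    (hs : (s : WithTop ℝ≥0) ≤ igLocTime W' J z n ω) :
    (s : WithTop ℝ≥0) < Loewner.swallowingTime (fun r ↦ W r ω) z :=
  (Loewner.imFlowStop_pos_iff h.continuous_snd hz).1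
    ((igLevel_pos_lt hz n).1.trans_le (h.level_le_imFlowStop hz hs))

/-- On `[0, ρₙ]`, `im z/(n+2) ≤ y_s = im z_s ≤ im z` (good path). [folklore] -/
theorem level_le_im_centredMap (h : GoodPath κ ρ O W W' J ω) (hz : 0 < z.im) {s : ℝ≥0}
    (hs : (s : WithTop ℝ≥0) ≤ igLocTime W' J z n ω) :
    igLevel z n ≤ (Loewner.centredMap (fun r ↦ W r ω) s z).im ∧
      (Loewner.centredMap (fun r ↦ W r ω) s z).im ≤ z.im := by
  have hsT := h.coe_lt_swallowingTime hz hs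
  refine ⟨?_, Loewner.im_centredMap_le h.continuous_snd hz hsT⟩
  have := h.level_le_imFlowStop hz hs
  rwa [Loewner.imFlowStop_of_lt hsT, ← Loewner.im_centredMap] at this

/-- **On `[0, ρₙ]` the driving function is bounded by `n + 1`** (good path, `ρₙ ≤ Sₙ`).
[folklore] -/
theorem abs_snd_le (h : GoodPath κ ρ O W W' J ω) {s : ℝ≥0}
    (hs : (s : WithTop ℝ≥0) ≤ igLocTime W' J z n ω) : |W s ω| ≤ n + 1 := by
  have hc : Continuous fun t ↦ (fun t ω ↦ |W' t ω|) t ω := by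
    show Continuous fun t ↦ |W' t ω|
    exact h.continuous.abs
  have h0 : (fun t ω ↦ |W' t ω|) 0 ω ≤ (n : ℝ) + 1 := by
    show |W' 0 ω| ≤ n + 1
    rw [h.eq 0]
    have : W 0 ω = 0 := by
      have h1 := h.eq_brownian 0
      rw [h.eq 0] at h1
      rw [h1, timeIntegral_apply_zero]
      simp [brownian_zero]
    rw [this, abs_zero]; positivity
  have hle := le_of_le_ratExceed hc h0 ((hs.trans (min_le_right _ _)).trans (min_le_left _ _))
  change |W' s ω| ≤ n + 1 at hle
  rwa [h.eq s] at hle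

/-- **On `[0, ρₙ]` the time integral `∫₀ J` is at most `n + 1`** (good path, `ρₙ ≤ Iₙ`).
[folklore] -/
theorem timeIntegral_le (h : GoodPath κ ρ O W W' J ω) {s : ℝ≥0}
    (hs : (s : WithTop ℝ≥0) ≤ igLocTime W' J z n ω) : timeIntegral J s ω ≤ n + 1 := by
  have hc : Continuous fun t ↦ (fun t ω ↦ timeIntegral J t ω) t ω := h.continuous_timeIntegral
  have h0 : (fun t ω ↦ timeIntegral J t ω) 0 ω ≤ (n : ℝ) + 1 := by
    show timeIntegral J 0 ω ≤ n + 1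
    rw [timeIntegral_apply_zero]; positivity
  exact le_of_le_ratExceed hc h0
    (((hs.trans (min_le_right _ _)).trans (min_le_right _ _)).trans (min_le_left _ _))

/-- The time integral `∫₀ˢ J` of a nonnegative process is nonnegative. [folklore] -/
theorem _root_.Literature.Probability.RandomPlanarGeometry.SLEKappaRho.timeIntegral_nonneg_of_nonneg
    {J : ℝ≥0 → (ℝ≥0 → ℝ) → ℝ} (hJ : ∀ t ω, 0 ≤ J t ω) (s : ℝ≥0) (ω : ℝ≥0 → ℝ) :
    0 ≤ timeIntegral J s ω :=
  intervalIntegral.integral_nonneg s.coe_nonneg fun _ _ ↦ hJ _ _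

/-- **On `[0, ρₙ]`, `0 ≤ Z'_s = W_s - O_s ≤ 3(n+1)`** (good path of a regular version; `Z' ≥ 0`
and `J ≥ 0` hold for every sample, `RegularPair.add_nonneg'`, `.nonneg`). [folklore] -/
theorem zPrime_mem_Icc (h : GoodPath κ ρ O W W' J ω) (hreg : RegularPair κ ρ W W' J) {s : ℝ≥0}
    (hs : (s : WithTop ℝ≥0) ≤ igLocTime W' J z n ω) :
    W' s ω + 2 * timeIntegral J s ω ∈ Icc (0 : ℝ) (3 * (n + 1)) := by
  have h1 := h.abs_snd_le hs
  rw [← h.eq s] at h1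
  have h2 := h.timeIntegral_le hs
  refine ⟨hreg.add_nonneg' s ω, by linarith [(abs_le.1 h1).2]⟩

/-- AM–GM: `|2 re Z/|Z|²| ≤ 1/im Z` for `im Z > 0`. [folklore] -/
theorem abs_two_mul_re_div_norm_sq_le {Z : ℂ} (hy : 0 < Z.im) : |2 * Z.re / ‖Z‖ ^ 2| ≤ (Z.im)⁻¹ := by
  have hsq : ‖Z‖ ^ 2 = Z.re ^ 2 + Z.im ^ 2 := by rw [Complex.sq_norm, normSq_apply]; ring
  have hQ : 0 < Z.re ^ 2 + Z.im ^ 2 := by positivity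
  rw [hsq, abs_div, abs_of_pos hQ, div_le_iff₀ hQ, abs_mul, abs_two]
  rw [inv_mul_eq_div, le_div_iff₀ hy]
  nlinarith [sq_nonneg (|Z.re| - Z.im), sq_abs Z.re]

/-- **On `[0, ρₙ]`, `|x_s| ≤ C_x`** (good path): `x_s = re z - W_s + ∫₀ˢ 2x/|z|²` with
`|2x/|z|²| ≤ 1/y ≤ (n+2)/im z` on a clock `≤ n+1` and `|W_s| ≤ n+1`. [folklore] -/
theorem abs_re_centredMap_le (h : GoodPath κ ρ O W W' J ω) (hz : 0 < z.im) {s : ℝ≥0}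
    (hs : (s : WithTop ℝ≥0) ≤ igLocTime W' J z n ω) :
    |(Loewner.centredMap (fun r ↦ W r ω) s z).re| ≤ igCx z n := by
  have hW := h.continuous_snd
  have hsT := h.coe_lt_swallowingTime hz hs
  have hsle : (s : ℝ) ≤ n + 1 := by
    have := hs.trans (igLocTime_le ω)
    exact_mod_cast WithTop.coe_le_coe.1 this
  rw [Loewner.re_centredMap_eq hW hz hsT]
  have hbound : ∀ r ∈ Set.uIoc (0 : ℝ) (s : ℝ), ‖2 * (Loewner.centredMap (fun r ↦ W r ω) r.toNNReal z).re /
      ‖Loewner.centredMap (fun r ↦ W r ω) r.toNNReal z‖ ^ 2‖ ≤ (n + 2) / z.im := by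
    intro r hr
    rw [uIoc_of_le s.coe_nonneg] at hr
    have hr' : ((r.toNNReal : ℝ≥0) : WithTop ℝ≥0) ≤ igLocTime W' J z n ω :=
      toNNReal_le_igLocTime_of_mem hs ⟨hr.1.le, hr.2⟩
    obtain ⟨hl, -⟩ := h.level_le_im_centredMap hz hr'
    have hy : 0 < (Loewner.centredMap (fun r ↦ W r ω) r.toNNReal z).im := (igLevel_pos_lt hz n).1.trans_le hl
    rw [Real.norm_eq_abs]
    refine (abs_two_mul_re_div_norm_sq_le hy).trans ?_
    rw [← inv_igLevel]
    exact inv_anti₀ (igLevel_pos_lt hz n).1 hl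
  have hI := intervalIntegral.norm_integral_le_of_norm_le_const hbound
  rw [Real.norm_eq_abs, sub_zero, abs_of_nonneg s.coe_nonneg] at hI
  have hWs := h.abs_snd_le hs
  have hC : 0 ≤ (n + 2 : ℝ) / z.im := by positivity
  calc |z.re - W s ω + ∫ r in (0 : ℝ)..s, 2 * (Loewner.centredMap (fun r ↦ W r ω) r.toNNReal z).re /
          ‖Loewner.centredMap (fun r ↦ W r ω) r.toNNReal z‖ ^ 2|
      ≤ |z.re| + |W s ω| + |∫ r in (0 : ℝ)..s, 2 * (Loewner.centredMap (fun r ↦ W r ω) r.toNNReal z).re /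
          ‖Loewner.centredMap (fun r ↦ W r ω) r.toNNReal z‖ ^ 2| := by
        refine (abs_add_le _ _).trans ?_
        gcongr
        exact abs_sub _ _
    _ ≤ |z.re| + (n + 1) + (n + 2) / z.im * s := by gcongr
    _ ≤ |z.re| + (n + 1) + (n + 2) / z.im * (n + 1) := by gcongr
    _ = igCx z n := by rw [igCx]; ring

end GoodPath

/-! ### The stopped, clamped processes and their coefficients -/

section Processes

variable (κ : ℝ≥0) (ρ : ℝ) (W' J : ℝ≥0 → (ℝ≥0 → ℝ) → ℝ) (z : ℂ) (n : ℕ)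

/-- `X`: `re z_t` stopped at `ρₙ` and clamped to `[-C_x, C_x]` (the clamp is inactive on good
paths, `GoodPath.igX_eq`). [cite: RohdeSchramm2005, Lemma 6.3 (proof)] -/
def igX : ℝ≥0 → (ℝ≥0 → ℝ) → ℝ := fun t ω ↦
  igClamp (igCx z n) (stoppedProcess (Loewner.xReg W' z) (igLocTime W' J z n) t ω)

/-- `Y`: the frozen imaginary part stopped at `ρₙ` and clamped to `[im z/(n+2), im z]`.
[cite: RohdeSchramm2005, Lemma 6.3 (proof)] -/
def igY : ℝ≥0 → (ℝ≥0 → ℝ) → ℝ := fun t ω ↦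
  max (igLevel z n) (min z.im (stoppedProcess (Loewner.yReg W' z) (igLocTime W' J z n) t ω))

/-- `Q = X² + Y² = |z_{t∧ρₙ}|²`. [folklore] -/
def igQ : ℝ≥0 → (ℝ≥0 → ℝ) → ℝ := fun t ω ↦ igX W' J z n t ω ^ 2 + igY W' J z n t ω ^ 2

/-- `1/Y`. [folklore] -/
def igInvY : ℝ≥0 → (ℝ≥0 → ℝ) → ℝ := fun t ω ↦ (igY W' J z n t ω)⁻¹

/-- `Z' = W - O` stopped at `ρₙ` and clamped to `[0, 3(n+1)]`. [folklore] -/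
def igZp : ℝ≥0 → (ℝ≥0 → ℝ) → ℝ := fun t ω ↦
  max 0 (min (3 * ((n : ℝ) + 1)) (stoppedProcess (zReg W' J) (igLocTime W' J z n) t ω))

/-- The truncated drift `𝟙_{s ≤ ρₙ} (2X/Q - ρ J)` of `X` (`dx = (2x/|z|²) dt - dW`,
`dW = ρ J dt + √κ dB`). [cite: MillerSheffield2016, Thm. 2.4 (proof)] -/
def igXDrift : ℝ≥0 → (ℝ≥0 → ℝ) → ℝ :=
  trunc (igLocTime W' J z n) fun s ω ↦ 2 * igX W' J z n s ω / igQ W' J z n s ω - ρ * J s ω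

/-- The truncated diffusion coefficient `𝟙_{s ≤ ρₙ} (-√κ)` of `X`. [folklore] -/
def igDiffusion : ℝ≥0 → (ℝ≥0 → ℝ) → ℝ :=
  trunc (igLocTime W' J z n) fun _ _ ↦ -Real.sqrt κ

/-- The truncated rate `𝟙_{s ≤ ρₙ} 2 (1/Y)/Q = 𝟙 2/(YQ)` of `1/Y`. [folklore] -/
def igInvYRate : ℝ≥0 → (ℝ≥0 → ℝ) → ℝ :=
  trunc (igLocTime W' J z n) fun s ω ↦ 2 * igInvY W' J z n s ω / igQ W' J z n s ω

/-- The truncated drift `𝟙_{s ≤ ρₙ} (ρ + 2) J` of `Z'` (`dZ = (ρ+2) dt/Z + √κ dB`). [cite: LawlerSchrammWerner2003Restriction, §8.3 (p. 36)] -/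
def igZpDrift : ℝ≥0 → (ℝ≥0 → ℝ) → ℝ :=
  trunc (igLocTime W' J z n) fun s ω ↦ (ρ + 2) * J s ω

/-- The truncated diffusion coefficient `𝟙_{s ≤ ρₙ} √κ` of `Z'`. [folklore] -/
def igZpDiffusion : ℝ≥0 → (ℝ≥0 → ℝ) → ℝ :=
  trunc (igLocTime W' J z n) fun _ _ ↦ Real.sqrt κ

/-- The truncated rate `𝟙_{s ≤ ρₙ} 4XY/Q²` of `arg g_t'(z)`. [cite: MillerSheffield2016, Thm. 2.4 (proof)] -/
def igARate : ℝ≥0 → (ℝ≥0 → ℝ) → ℝ :=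
  trunc (igLocTime W' J z n) fun s ω ↦ 4 * igX W' J z n s ω * igY W' J z n s ω / igQ W' J z n s ω ^ 2

/-- `A = ∫₀ᵗ 𝟙_{s ≤ ρₙ} 4XY/Q² ds` (`= arg g_{t∧ρₙ}'(z)` on good paths, `GoodPath.igA_eq`).
[cite: MillerSheffield2016, Thm. 2.4 (proof)] -/
def igA : ℝ≥0 → (ℝ≥0 → ℝ) → ℝ := timeIntegral (igARate W' J z n)

end Processes

/-! ### Bounds valid for every sample -/

section Bounds

variable {κ : ℝ≥0} {ρ : ℝ} {W' J : ℝ≥0 → (ℝ≥0 → ℝ) → ℝ} {z : ℂ} {n : ℕ}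

/-- `|X| ≤ C_x`. [folklore] -/
theorem abs_igX_le (hz : 0 < z.im) (t : ℝ≥0) (ω : ℝ≥0 → ℝ) : |igX W' J z n t ω| ≤ igCx z n :=
  abs_igClamp_le (igCx_nonneg hz n) _

/-- `im z/(n+2) ≤ Y`. [folklore] -/
theorem igLevel_le_igY (t : ℝ≥0) (ω : ℝ≥0 → ℝ) : igLevel z n ≤ igY W' J z n t ω := le_max_left _ _

/-- `0 < Y`. [folklore] -/
theorem igY_pos (hz : 0 < z.im) (t : ℝ≥0) (ω : ℝ≥0 → ℝ) : 0 < igY W' J z n t ω :=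
  (igLevel_pos_lt hz n).1.trans_le (igLevel_le_igY t ω)

/-- `Y ≤ im z`. [folklore] -/
theorem igY_le (hz : 0 < z.im) (t : ℝ≥0) (ω : ℝ≥0 → ℝ) : igY W' J z n t ω ≤ z.im :=
  max_le (igLevel_pos_lt hz n).2.le (min_le_left _ _)

/-- `Y² ≤ Q`. [folklore] -/
theorem sq_igY_le_igQ (t : ℝ≥0) (ω : ℝ≥0 → ℝ) : igY W' J z n t ω ^ 2 ≤ igQ W' J z n t ω := by
  rw [igQ]; nlinarith [sq_nonneg (igX W' J z n t ω)]

/-- `(im z/(n+2))² ≤ Q`. [folklore] -/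
theorem sq_level_le_igQ (hz : 0 < z.im) (t : ℝ≥0) (ω : ℝ≥0 → ℝ) : igLevel z n ^ 2 ≤ igQ W' J z n t ω :=
  (pow_le_pow_left₀ (igLevel_pos_lt hz n).1.le (igLevel_le_igY t ω) 2).trans (sq_igY_le_igQ t ω)

/-- `0 < Q`. [folklore] -/
theorem igQ_pos (hz : 0 < z.im) (t : ℝ≥0) (ω : ℝ≥0 → ℝ) : 0 < igQ W' J z n t ω :=
  (pow_pos (igLevel_pos_lt hz n).1 2).trans_le (sq_level_le_igQ hz t ω)

/-- `0 < 1/Y`. [folklore] -/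
theorem igInvY_pos (hz : 0 < z.im) (t : ℝ≥0) (ω : ℝ≥0 → ℝ) : 0 < igInvY W' J z n t ω :=
  inv_pos.2 (igY_pos hz t ω)

/-- `|1/Y| ≤ (n+2)/im z`. [folklore] -/
theorem abs_igInvY_le (hz : 0 < z.im) (t : ℝ≥0) (ω : ℝ≥0 → ℝ) :
    |igInvY W' J z n t ω| ≤ (n + 2) / z.im := by
  rw [abs_of_pos (igInvY_pos hz t ω), igInvY, ← inv_igLevel]
  exact inv_anti₀ (igLevel_pos_lt hz n).1 (igLevel_le_igY t ω)

/-- `1/Q ≤ ((n+2)/im z)²`. [folklore] -/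
theorem inv_igQ_le (hz : 0 < z.im) (t : ℝ≥0) (ω : ℝ≥0 → ℝ) :
    (igQ W' J z n t ω)⁻¹ ≤ ((n + 2) / z.im) ^ 2 := by
  calc (igQ W' J z n t ω)⁻¹ ≤ (igLevel z n ^ 2)⁻¹ :=
        inv_anti₀ (pow_pos (igLevel_pos_lt hz n).1 2) (sq_level_le_igQ hz t ω)
    _ = ((n + 2) / z.im) ^ 2 := by rw [← inv_pow, inv_igLevel]

/-- `0 ≤ Z' ≤ 3(n+1)`. [folklore] -/
theorem igZp_mem_Icc (t : ℝ≥0) (ω : ℝ≥0 → ℝ) : igZp W' J z n t ω ∈ Icc (0 : ℝ) (3 * (n + 1)) :=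
  ⟨le_max_left _ _, max_le (by positivity) (min_le_left _ _)⟩

/-- AM–GM: `|2X/Q| ≤ 1/Y`. [folklore] -/
theorem abs_two_mul_igX_div_igQ_le (hz : 0 < z.im) (t : ℝ≥0) (ω : ℝ≥0 → ℝ) :
    |2 * igX W' J z n t ω / igQ W' J z n t ω| ≤ igInvY W' J z n t ω := by
  have hY := igY_pos hz t ω (W' := W') (J := J) (z := z) (n := n)
  have hQ := igQ_pos hz t ω (W' := W') (J := J) (z := z) (n := n)
  rw [abs_div, abs_of_pos hQ, div_le_iff₀ hQ, abs_mul, abs_two, igInvY, inv_mul_eq_div,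
    le_div_iff₀ hY, igQ]
  nlinarith [sq_nonneg (|igX W' J z n t ω| - igY W' J z n t ω), sq_abs (igX W' J z n t ω)]

/-- `|Y/Q| ≤ 1/Y`. [folklore] -/
theorem abs_igY_div_igQ_le (hz : 0 < z.im) (t : ℝ≥0) (ω : ℝ≥0 → ℝ) :
    |igY W' J z n t ω / igQ W' J z n t ω| ≤ igInvY W' J z n t ω := by
  have hY := igY_pos hz t ω (W' := W') (J := J) (z := z) (n := n)
  have hQ := igQ_pos hz t ω (W' := W') (J := J) (z := z) (n := n)
  rw [abs_div, abs_of_pos hQ, abs_of_pos hY, div_le_iff₀ hQ, igInvY, inv_mul_eq_div,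
    le_div_iff₀ hY]
  nlinarith [sq_igY_le_igQ (W' := W') (J := J) (z := z) (n := n) t ω]

/-- `|𝟙 2X/Q - …|`-free bound on the drift of `X` apart from `J`: `|2X/Q| ≤ (n+2)/im z`. [folklore] -/
theorem abs_two_mul_igX_div_igQ_le' (hz : 0 < z.im) (t : ℝ≥0) (ω : ℝ≥0 → ℝ) :
    |2 * igX W' J z n t ω / igQ W' J z n t ω| ≤ (n + 2) / z.im :=
  (abs_two_mul_igX_div_igQ_le hz t ω).trans
    ((le_abs_self _).trans (abs_igInvY_le hz t ω))

/-- `|2(1/Y)/Q| ≤ 2((n+2)/im z)³`. [folklore] -/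
theorem abs_two_mul_igInvY_div_igQ_le (hz : 0 < z.im) (t : ℝ≥0) (ω : ℝ≥0 → ℝ) :
    |2 * igInvY W' J z n t ω / igQ W' J z n t ω| ≤ 2 * ((n + 2) / z.im) ^ 3 := by
  have hQ := igQ_pos hz t ω (W' := W') (J := J) (z := z) (n := n)
  have hI := igInvY_pos hz t ω (W' := W') (J := J) (z := z) (n := n)
  rw [abs_of_pos (div_pos (mul_pos two_pos hI) hQ), div_eq_mul_inv]
  have h1 := abs_igInvY_le hz t ω (W' := W') (J := J) (z := z) (n := n)
  rw [abs_of_pos hI] at h1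
  have h2 := inv_igQ_le hz t ω (W' := W') (J := J) (z := z) (n := n)
  have h0 : 0 ≤ (n + 2 : ℝ) / z.im := by positivity
  calc 2 * igInvY W' J z n t ω * (igQ W' J z n t ω)⁻¹
      ≤ 2 * ((n + 2) / z.im) * ((n + 2) / z.im) ^ 2 := by gcongr
    _ = 2 * ((n + 2) / z.im) ^ 3 := by ring

/-- `|4XY/Q²| ≤ 2((n+2)/im z)²` (`2|X|Y ≤ Q`). [folklore] -/
theorem abs_igARateU_le (hz : 0 < z.im) (t : ℝ≥0) (ω : ℝ≥0 → ℝ) :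
    |4 * igX W' J z n t ω * igY W' J z n t ω / igQ W' J z n t ω ^ 2| ≤ 2 * ((n + 2) / z.im) ^ 2 := by
  have hY := igY_pos hz t ω (W' := W') (J := J) (z := z) (n := n)
  have hQ := igQ_pos hz t ω (W' := W') (J := J) (z := z) (n := n)
  have hAM : 2 * |igX W' J z n t ω| * igY W' J z n t ω ≤ igQ W' J z n t ω := by
    rw [igQ]; nlinarith [sq_nonneg (|igX W' J z n t ω| - igY W' J z n t ω), sq_abs (igX W' J z n t ω)]
  have h1 : |4 * igX W' J z n t ω * igY W' J z n t ω / igQ W' J z n t ω ^ 2| ≤ 2 / igQ W' J z n t ω := by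
    rw [abs_div, abs_of_pos (pow_pos hQ 2), div_le_div_iff₀ (pow_pos hQ 2) hQ, abs_mul, abs_mul,
      abs_of_pos hY, show |(4 : ℝ)| = 4 by norm_num]
    nlinarith
  refine h1.trans ?_
  rw [div_eq_mul_inv]
  have := inv_igQ_le hz t ω (W' := W') (J := J) (z := z) (n := n)
  gcongr

/-- `|σ| ≤ √κ` for both diffusion coefficients. [folklore] -/
theorem abs_igDiffusion_le (t : ℝ≥0) (ω : ℝ≥0 → ℝ) : |igDiffusion κ W' J z n t ω| ≤ Real.sqrt κ := by
  rw [igDiffusion, trunc_apply]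
  split_ifs
  · rw [abs_neg, abs_of_nonneg (Real.sqrt_nonneg _)]
  · rw [abs_zero]; exact Real.sqrt_nonneg _

/-- See `abs_igDiffusion_le`. [folklore] -/
theorem abs_igZpDiffusion_le (t : ℝ≥0) (ω : ℝ≥0 → ℝ) : |igZpDiffusion κ W' J z n t ω| ≤ Real.sqrt κ := by
  rw [igZpDiffusion, trunc_apply]
  split_ifs
  · rw [abs_of_nonneg (Real.sqrt_nonneg _)]
  · rw [abs_zero]; exact Real.sqrt_nonneg _

/-- The two diffusion coefficients are opposite. [folklore] -/
theorem igZpDiffusion_eq_neg (t : ℝ≥0) (ω : ℝ≥0 → ℝ) :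
    igZpDiffusion κ W' J z n t ω = -igDiffusion κ W' J z n t ω := by
  rw [igZpDiffusion, igDiffusion, trunc_apply, trunc_apply]
  split_ifs <;> simp

/-- `X₀ = re z` for every sample (`x₀ = re z`, `|re z| ≤ C_x`). [folklore] -/
theorem igX_zero (hz : 0 < z.im) (h0 : ∀ ω, W' 0 ω = 0) (ω : ℝ≥0 → ℝ) : igX W' J z n 0 ω = z.re := by
  have h1 : stoppedProcess (Loewner.xReg W' z) (igLocTime W' J z n) 0 ω = Loewner.xReg W' z 0 ω := by
    rw [stoppedProcess_eq_of_le (by simp)]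
  have h2 : Loewner.xReg W' z 0 ω = z.re := by
    rw [Loewner.xReg, dyadicReg_apply_zero]
    show (Loewner.cmapProc W' z 0 ω).re = z.re
    have hc := Loewner.continuous_drivingUpTo W' 0 ω
    have hU0 : Loewner.drivingUpTo W' 0 ω 0 = 0 := by rw [Loewner.drivingUpTo_apply_zero, h0]
    have hzU : z ≠ Loewner.drivingUpTo W' 0 ω 0 := by
      rw [hU0]; exact Loewner.ne_driving_of_im_pos (W := fun _ ↦ (0 : ℝ)) hz 0
    rw [Loewner.cmapProc, Loewner.centredMap_zero hc hzU, hU0]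
    simp
  rw [igX, h1, h2, igClamp_of_abs_le]
  rw [igCx]
  have : 0 ≤ (n + 1 : ℝ) + (n + 1) * ((n + 2) / z.im) := by positivity
  linarith [abs_nonneg z.re]

end Bounds

/-! ### Progressive measurability -/

section Progressive

variable {κ : ℝ≥0} {ρ : ℝ} {W W' J : ℝ≥0 → (ℝ≥0 → ℝ) → ℝ} {z : ℂ} {n : ℕ}

/-- `X` is progressively measurable (progressive `xReg` stopped at the optional `ρₙ`, clamped).
[folklore] -/
theorem isStronglyProgressive_igX (h : RegularPair κ ρ W W' J) (hz : 0 < z.im) (n : ℕ) :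
    IsStronglyProgressive brownianFiltration (igX W' J z n) :=
  IsStronglyProgressive.continuous_comp
    ((isOptionalTime_igLocTime h hz n).isStronglyProgressive_stoppedProcess (h.isStronglyProgressive_xReg hz))
    (continuous_igClamp _)

/-- `Y` is progressively measurable. [folklore] -/
theorem isStronglyProgressive_igY (h : RegularPair κ ρ W W' J) (hz : 0 < z.im) (n : ℕ) :
    IsStronglyProgressive brownianFiltration (igY W' J z n) :=
  IsStronglyProgressive.continuous_comp
    ((isOptionalTime_igLocTime h hz n).isStronglyProgressive_stoppedProcess (h.isStronglyProgressive_yReg hz))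
    (φ := fun v ↦ max (igLevel z n) (min z.im v)) (continuous_const.max (continuous_const.min continuous_id))

/-- `Q` is progressively measurable. [folklore] -/
theorem isStronglyProgressive_igQ (h : RegularPair κ ρ W W' J) (hz : 0 < z.im) (n : ℕ) :
    IsStronglyProgressive brownianFiltration (igQ W' J z n) :=
  (IsStronglyProgressive.continuous_comp (isStronglyProgressive_igX h hz n) (continuous_pow 2)).add
    (IsStronglyProgressive.continuous_comp (isStronglyProgressive_igY h hz n) (continuous_pow 2))

/-- `1/Y` is progressively measurable. [folklore] -/
theorem isStronglyProgressive_igInvY (h : RegularPair κ ρ W W' J) (hz : 0 < z.im) (n : ℕ) :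
    IsStronglyProgressive brownianFiltration (igInvY W' J z n) := fun i ↦
  ((isStronglyProgressive_igY h hz n i).measurable.inv).stronglyMeasurable

/-- `Z'` (stopped, clamped) is progressively measurable. [folklore] -/
theorem isStronglyProgressive_igZp (h : RegularPair κ ρ W W' J) (hz : 0 < z.im) (n : ℕ) :
    IsStronglyProgressive brownianFiltration (igZp W' J z n) :=
  IsStronglyProgressive.continuous_comp
    ((isOptionalTime_igLocTime h hz n).isStronglyProgressive_stoppedProcess h.isStronglyProgressive_zReg)
    (φ := fun v ↦ max 0 (min (3 * ((n : ℝ) + 1)) v)) (continuous_const.max (continuous_const.min continuous_id))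

/-- `1/Q` is progressively measurable. [folklore] -/
theorem isStronglyProgressive_inv_igQ (h : RegularPair κ ρ W W' J) (hz : 0 < z.im) (n : ℕ) :
    IsStronglyProgressive brownianFiltration fun s ω ↦ (igQ W' J z n s ω)⁻¹ := fun i ↦
  ((isStronglyProgressive_igQ h hz n i).measurable.inv).stronglyMeasurable

/-- The drift of `X` is progressively measurable. [folklore] -/
theorem isStronglyProgressive_igXDrift (h : RegularPair κ ρ W W' J) (hz : 0 < z.im) (n : ℕ) :
    IsStronglyProgressive brownianFiltration (igXDrift ρ W' J z n) := by
  refine isStronglyProgressive_trunc ?_ (isOptionalTime_igLocTime h hz n)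
  have h1 : IsStronglyProgressive brownianFiltration fun s ω ↦ 2 * igX W' J z n s ω / igQ W' J z n s ω := by
    simpa [div_eq_mul_inv] using
      ((isStronglyProgressive_const _ (2 : ℝ)).mul (isStronglyProgressive_igX h hz n)).mul
        (isStronglyProgressive_inv_igQ h hz n)
  exact h1.sub ((isStronglyProgressive_const _ ρ).mul h.progressive)

/-- The diffusion coefficient of `X` is progressively measurable. [folklore] -/
theorem isStronglyProgressive_igDiffusion (h : RegularPair κ ρ W W' J) (hz : 0 < z.im) (n : ℕ) :
    IsStronglyProgressive brownianFiltration (igDiffusion κ W' J z n) :=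
  isStronglyProgressive_trunc (isStronglyProgressive_const _ _) (isOptionalTime_igLocTime h hz n)

/-- The rate of `1/Y` is progressively measurable. [folklore] -/
theorem isStronglyProgressive_igInvYRate (h : RegularPair κ ρ W W' J) (hz : 0 < z.im) (n : ℕ) :
    IsStronglyProgressive brownianFiltration (igInvYRate W' J z n) := by
  refine isStronglyProgressive_trunc ?_ (isOptionalTime_igLocTime h hz n)
  simpa [div_eq_mul_inv] using
    ((isStronglyProgressive_const _ (2 : ℝ)).mul (isStronglyProgressive_igInvY h hz n)).mul
      (isStronglyProgressive_inv_igQ h hz n)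

/-- The drift of `Z'` is progressively measurable. [folklore] -/
theorem isStronglyProgressive_igZpDrift (h : RegularPair κ ρ W W' J) (hz : 0 < z.im) (n : ℕ) :
    IsStronglyProgressive brownianFiltration (igZpDrift ρ W' J z n) :=
  isStronglyProgressive_trunc ((isStronglyProgressive_const _ _).mul h.progressive)
    (isOptionalTime_igLocTime h hz n)

/-- The diffusion coefficient of `Z'` is progressively measurable. [folklore] -/
theorem isStronglyProgressive_igZpDiffusion (h : RegularPair κ ρ W W' J) (hz : 0 < z.im) (n : ℕ) :
    IsStronglyProgressive brownianFiltration (igZpDiffusion κ W' J z n) :=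
  isStronglyProgressive_trunc (isStronglyProgressive_const _ _) (isOptionalTime_igLocTime h hz n)

/-- The rate of `A` is progressively measurable. [folklore] -/
theorem isStronglyProgressive_igARate (h : RegularPair κ ρ W W' J) (hz : 0 < z.im) (n : ℕ) :
    IsStronglyProgressive brownianFiltration (igARate W' J z n) := by
  refine isStronglyProgressive_trunc ?_ (isOptionalTime_igLocTime h hz n)
  have hQ2 : IsStronglyProgressive brownianFiltration fun s ω ↦ (igQ W' J z n s ω ^ 2)⁻¹ := fun i ↦
    (((IsStronglyProgressive.continuous_comp (isStronglyProgressive_igQ h hz n) (continuous_pow 2)) i).measurable.inv).stronglyMeasurable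
  simpa [div_eq_mul_inv] using
    ((((isStronglyProgressive_const _ (4 : ℝ)).mul (isStronglyProgressive_igX h hz n)).mul
      (isStronglyProgressive_igY h hz n))).mul hQ2

/-- `A` is adapted (time integral of a progressive process). [folklore] -/
theorem adapted_igA (h : RegularPair κ ρ W W' J) (hz : 0 < z.im) (n : ℕ) :
    Adapted brownianFiltration (igA W' J z n) := fun t ↦
  adapted_timeIntegral (isStronglyProgressive_igARate h hz n) t

/-- Every path of the rate of `1/Y` is integrable on compacts (bounded with Borel path).
[folklore] -/
theorem integrableOn_igInvYRate (h : RegularPair κ ρ W W' J) (hz : 0 < z.im) (n : ℕ) (ω : ℝ≥0 → ℝ)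
    (t : ℝ≥0) : IntegrableOn (fun s : ℝ ↦ igInvYRate W' J z n s.toNNReal ω) (Icc 0 t) := by
  have hm := measurable_path_of_isStronglyProgressive (isStronglyProgressive_igInvYRate h hz n) ω
  have hb : ∀ r : ℝ, |igInvYRate W' J z n r.toNNReal ω| ≤ 2 * ((n + 2) / z.im) ^ 3 := by
    intro r
    rw [igInvYRate, trunc_apply]
    split_ifs
    · exact abs_two_mul_igInvY_div_igQ_le hz _ _
    · rw [abs_zero]; positivity
  exact (intervalIntegrable_iff_integrableOn_Icc_of_le t.coe_nonneg).1
    (intervalIntegrable_of_bdd hm hb 0 t)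

/-- Every path of the rate of `A` is integrable on compacts. [folklore] -/
theorem integrableOn_igARate (h : RegularPair κ ρ W W' J) (hz : 0 < z.im) (n : ℕ) (ω : ℝ≥0 → ℝ)
    (t : ℝ≥0) : IntegrableOn (fun s : ℝ ↦ igARate W' J z n s.toNNReal ω) (Icc 0 t) := by
  have hm := measurable_path_of_isStronglyProgressive (isStronglyProgressive_igARate h hz n) ω
  have hb : ∀ r : ℝ, |igARate W' J z n r.toNNReal ω| ≤ 2 * ((n + 2) / z.im) ^ 2 := by
    intro r
    rw [igARate, trunc_apply]
    split_ifs
    · exact abs_igARateU_le hz _ _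
    · rw [abs_zero]; positivity
  exact (intervalIntegrable_iff_integrableOn_Icc_of_le t.coe_nonneg).1
    (intervalIntegrable_of_bdd hm hb 0 t)

end Progressive

/-! ### Identification on good paths -/

namespace GoodPath

variable {κ : ℝ≥0} {ρ : ℝ} {O W W' J : ℝ≥0 → (ℝ≥0 → ℝ) → ℝ} {ω : ℝ≥0 → ℝ} {z : ℂ} {n : ℕ}

/-- The stopped clock is before the swallowing time (good path). [folklore] -/
theorem igClock_lt_swallowingTime (h : GoodPath κ ρ O W W' J ω) (hz : 0 < z.im) (t : ℝ≥0) :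
    (((min (t : WithTop ℝ≥0) (igLocTime W' J z n ω)).untopA : ℝ≥0) : WithTop ℝ≥0) <
      Loewner.swallowingTime (fun r ↦ W r ω) z :=
  h.coe_lt_swallowingTime hz (igClock_le t ω)

/-- **`X_t = x_{t∧ρₙ}`** on a good path. [folklore] -/
theorem igX_eq (h : GoodPath κ ρ O W W' J ω) (hz : 0 < z.im) (t : ℝ≥0) :
    igX W' J z n t ω = (Loewner.centredMap (fun r ↦ W r ω)
      ((min (t : WithTop ℝ≥0) (igLocTime W' J z n ω)).untopA) z).re := by
  have hu := igClock_le (W' := W') (J := J) (z := z) (n := n) t ω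
  rw [igX]
  show igClamp (igCx z n) (Loewner.xReg W' z _ ω) = _
  rw [h.xReg_eq hz (h.igClock_lt_swallowingTime hz t), igClamp_of_abs_le (h.abs_re_centredMap_le hz hu)]

/-- **`Y_t = y_{t∧ρₙ} = im z_{t∧ρₙ}`** on a good path. [folklore] -/
theorem igY_eq (h : GoodPath κ ρ O W W' J ω) (hz : 0 < z.im) (t : ℝ≥0) :
    igY W' J z n t ω = (Loewner.centredMap (fun r ↦ W r ω)
      ((min (t : WithTop ℝ≥0) (igLocTime W' J z n ω)).untopA) z).im := by
  have hu := igClock_le (W' := W') (J := J) (z := z) (n := n) t ω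
  have huT := h.igClock_lt_swallowingTime hz t (n := n)
  obtain ⟨h1, h2⟩ := h.level_le_im_centredMap hz hu
  rw [igY]
  show max (igLevel z n) (min z.im (Loewner.yReg W' z _ ω)) = _
  rw [h.yReg_eq hz, Loewner.imFlowStop_of_lt huT, ← Loewner.im_centredMap, min_eq_right h2,
    max_eq_right h1]

/-- **`Q_t = |z_{t∧ρₙ}|²`** on a good path. [folklore] -/
theorem igQ_eq (h : GoodPath κ ρ O W W' J ω) (hz : 0 < z.im) (t : ℝ≥0) :
    igQ W' J z n t ω = ‖Loewner.centredMap (fun r ↦ W r ω)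
      ((min (t : WithTop ℝ≥0) (igLocTime W' J z n ω)).untopA) z‖ ^ 2 := by
  rw [igQ, h.igX_eq hz, h.igY_eq hz, Complex.sq_norm, normSq_apply]; ring

/-- **`Zp_t = Z'_{t∧ρₙ} = W'_{t∧ρₙ} + 2∫₀^{t∧ρₙ} J`** on a good path of a regular version. [folklore] -/
theorem igZp_eq (h : GoodPath κ ρ O W W' J ω) (hreg : RegularPair κ ρ W W' J) (t : ℝ≥0) :
    igZp W' J z n t ω = W' ((min (t : WithTop ℝ≥0) (igLocTime W' J z n ω)).untopA) ω +
      2 * timeIntegral J ((min (t : WithTop ℝ≥0) (igLocTime W' J z n ω)).untopA) ω := by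
  have hu := igClock_le (W' := W') (J := J) (z := z) (n := n) t ω
  obtain ⟨h1, h2⟩ := h.zPrime_mem_Icc hreg hu (z := z) (n := n)
  rw [igZp]
  show max 0 (min (3 * ((n : ℝ) + 1)) (zReg W' J _ ω)) = _
  rw [h.zReg_eq, min_eq_right h2, max_eq_right h1]

/-- Versions at a time `s ≤ ρₙ` (the clock of `s` is `s`). [folklore] -/
theorem igX_eq_of_le (h : GoodPath κ ρ O W W' J ω) (hz : 0 < z.im) {s : ℝ≥0}
    (hs : (s : WithTop ℝ≥0) ≤ igLocTime W' J z n ω) :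
    igX W' J z n s ω = (Loewner.centredMap (fun r ↦ W r ω) s z).re := by
  rw [h.igX_eq hz, igClock_eq_of_le hs]

/-- See `igX_eq_of_le`. [folklore] -/
theorem igY_eq_of_le (h : GoodPath κ ρ O W W' J ω) (hz : 0 < z.im) {s : ℝ≥0}
    (hs : (s : WithTop ℝ≥0) ≤ igLocTime W' J z n ω) :
    igY W' J z n s ω = (Loewner.centredMap (fun r ↦ W r ω) s z).im := by
  rw [h.igY_eq hz, igClock_eq_of_le hs]

/-- See `igX_eq_of_le`. [folklore] -/
theorem igQ_eq_of_le (h : GoodPath κ ρ O W W' J ω) (hz : 0 < z.im) {s : ℝ≥0}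
    (hs : (s : WithTop ℝ≥0) ≤ igLocTime W' J z n ω) :
    igQ W' J z n s ω = ‖Loewner.centredMap (fun r ↦ W r ω) s z‖ ^ 2 := by
  rw [h.igQ_eq hz, igClock_eq_of_le hs]

/-- See `igX_eq_of_le`. [folklore] -/
theorem igZp_eq_of_le (h : GoodPath κ ρ O W W' J ω) (hreg : RegularPair κ ρ W W' J) {s : ℝ≥0}
    (hs : (s : WithTop ℝ≥0) ≤ igLocTime W' J z n ω) :
    igZp W' J z n s ω = W' s ω + 2 * timeIntegral J s ω := by
  rw [h.igZp_eq hreg, igClock_eq_of_le hs]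

/-! ### The integrated equations on good paths -/

/-- **The integrated Loewner–Bessel equation for `X`** on a good path: with `u = t ∧ ρₙ`,
`X_t = re z + ∫₀ᵗ 𝟙_{s≤ρₙ} (2X_s/Q_s - ρ J_s) ds - √κ B_u` (`x_u = re z - W_u + ∫₀ᵘ 2x/|z|²`,
`Loewner.re_centredMap_eq`, and `W_u = √κ B_u + ρ ∫₀ᵘ J`). This is "`dx = (2x/|z|²) dt - dW`,
`dW = ρ J dt + √κ dB`" integrated. [cite: MillerSheffield2016, Thm. 2.4 (proof)] -/
theorem igX_eq_integral (h : GoodPath κ ρ O W W' J ω) (hz : 0 < z.im) (t : ℝ≥0) :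
    igX W' J z n t ω = z.re + timeIntegral (igXDrift ρ W' J z n) t ω -
      Real.sqrt κ * brownian ((min (t : WithTop ℝ≥0) (igLocTime W' J z n ω)).untopA) ω := by
  set u : ℝ≥0 := (min (t : WithTop ℝ≥0) (igLocTime W' J z n ω)).untopA with hu
  have huρ : (u : WithTop ℝ≥0) ≤ igLocTime W' J z n ω := igClock_le t ω
  have huT := h.igClock_lt_swallowingTime hz t (n := n)
  have hW := h.continuous_snd
  -- the drift integral up to the clock
  have hD : timeIntegral (igXDrift ρ W' J z n) t ω = (∫ s in (0 : ℝ)..u,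
      2 * (Loewner.centredMap (fun r ↦ W r ω) s.toNNReal z).re /
        ‖Loewner.centredMap (fun r ↦ W r ω) s.toNNReal z‖ ^ 2) - ρ * timeIntegral J u ω := by
    rw [igXDrift, timeIntegral_trunc, ← hu]
    simp only [timeIntegral]
    have hint1 : IntervalIntegrable (fun s : ℝ ↦ 2 * (Loewner.centredMap (fun r ↦ W r ω) s.toNNReal z).re /
        ‖Loewner.centredMap (fun r ↦ W r ω) s.toNNReal z‖ ^ 2) volume 0 u := by
      refine ContinuousOn.intervalIntegrable_of_Icc u.coe_nonneg ?_
      have hc := Loewner.continuousOn_centredMap_toNNReal hW hz huT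
      refine (continuousOn_const.mul (continuous_re.comp_continuousOn hc)).div (hc.norm.pow 2)
        fun s hs ↦ pow_ne_zero 2 (norm_ne_zero_iff.2 ?_)
      exact Loewner.centredMap_ne_zero hW hz (Loewner.toNNReal_lt_swallowingTime_of_mem huT hs)
    have hint2 : IntervalIntegrable (fun s : ℝ ↦ ρ * J s.toNNReal ω) volume 0 u :=
      (h.intervalIntegrable u).const_mul ρ
    rw [← intervalIntegral.integral_const_mul, ← intervalIntegral.integral_sub hint1 hint2]
    refine intervalIntegral.integral_congr fun s hs ↦ ?_
    rw [uIcc_of_le u.coe_nonneg] at hs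
    have hsρ := toNNReal_le_igLocTime_of_mem huρ hs
    simp only [h.igX_eq_of_le hz hsρ, h.igQ_eq_of_le hz hsρ]
  rw [h.igX_eq hz, ← hu, Loewner.re_centredMap_eq hW hz huT, hD, ← h.eq u, h.eq_brownian u]
  ring

/-- **`1/Y_t = 1/im z + ∫₀ᵗ 𝟙_{s≤ρₙ} 2/(Y_s Q_s) ds`** on a good path
(`Loewner.inv_im_centredMap_eq` at the stopped clock). [cite: RohdeSchramm2005, Lemma 6.3 (proof)] -/
theorem igInvY_eq_integral (h : GoodPath κ ρ O W W' J ω) (hz : 0 < z.im) (t : ℝ≥0) :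
    igInvY W' J z n t ω = (z.im)⁻¹ + timeIntegral (igInvYRate W' J z n) t ω := by
  set u : ℝ≥0 := (min (t : WithTop ℝ≥0) (igLocTime W' J z n ω)).untopA with hu
  have huρ : (u : WithTop ℝ≥0) ≤ igLocTime W' J z n ω := igClock_le t ω
  have huT := h.igClock_lt_swallowingTime hz t (n := n)
  have hW := h.continuous_snd
  have hint : timeIntegral (igInvYRate W' J z n) t ω = ∫ s in (0 : ℝ)..u,
      2 / ((Loewner.centredMap (fun r ↦ W r ω) s.toNNReal z).im *
        ‖Loewner.centredMap (fun r ↦ W r ω) s.toNNReal z‖ ^ 2) := by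
    rw [igInvYRate, timeIntegral_trunc, ← hu]
    simp only [timeIntegral]
    refine intervalIntegral.integral_congr fun s hs ↦ ?_
    rw [uIcc_of_le u.coe_nonneg] at hs
    have hsρ := toNNReal_le_igLocTime_of_mem huρ hs
    simp only [igInvY, h.igY_eq_of_le hz hsρ, h.igQ_eq_of_le hz hsρ]
    ring
  rw [igInvY, h.igY_eq hz, ← hu, hint, Loewner.inv_im_centredMap_eq hW hz huT]

/-- **`Zp_t = ∫₀ᵗ 𝟙_{s≤ρₙ} (ρ+2) J_s ds + √κ B_u`** on a good path of a regular version
(`Z'_u = √κ B_u + (ρ+2) ∫₀ᵘ J`). [cite: LawlerSchrammWerner2003Restriction, §8.3 (p. 36)] -/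
theorem igZp_eq_integral (h : GoodPath κ ρ O W W' J ω) (hreg : RegularPair κ ρ W W' J) (t : ℝ≥0) :
    igZp W' J z n t ω = timeIntegral (igZpDrift ρ W' J z n) t ω +
      Real.sqrt κ * brownian ((min (t : WithTop ℝ≥0) (igLocTime W' J z n ω)).untopA) ω := by
  set u : ℝ≥0 := (min (t : WithTop ℝ≥0) (igLocTime W' J z n ω)).untopA with hu
  have hD : timeIntegral (igZpDrift ρ W' J z n) t ω = (ρ + 2) * timeIntegral J u ω := by
    rw [igZpDrift, timeIntegral_trunc, ← hu]
    simp only [timeIntegral]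
    rw [intervalIntegral.integral_const_mul]
  rw [h.igZp_eq hreg, ← hu, hD, h.zPrime_eq_brownian u]
  ring

/-- **`A_t = arg g_u'(z)`**, `u = t ∧ ρₙ`, on a good path (`Loewner.argDeriv_eq_integral` at the
stopped clock; `|z_s|⁴ = Q_s²`). [cite: MillerSheffield2016, Thm. 2.4 (proof)] -/
theorem igA_eq (h : GoodPath κ ρ O W W' J ω) (hz : 0 < z.im) (t : ℝ≥0) :
    igA W' J z n t ω = Loewner.argDeriv (fun r ↦ W r ω)
      ((min (t : WithTop ℝ≥0) (igLocTime W' J z n ω)).untopA) z := by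
  set u : ℝ≥0 := (min (t : WithTop ℝ≥0) (igLocTime W' J z n ω)).untopA with hu
  have huρ : (u : WithTop ℝ≥0) ≤ igLocTime W' J z n ω := igClock_le t ω
  have huT := h.igClock_lt_swallowingTime hz t (n := n)
  rw [igA, igARate, timeIntegral_trunc, ← hu, Loewner.argDeriv_eq_integral h.continuous_snd hz huT]
  simp only [timeIntegral]
  refine intervalIntegral.integral_congr fun s hs ↦ ?_
  rw [uIcc_of_le u.coe_nonneg] at hs
  have hsρ := toNNReal_le_igLocTime_of_mem huρ hs
  simp only [h.igX_eq_of_le hz hsρ, h.igY_eq_of_le hz hsρ, h.igQ_eq_of_le hz hsρ]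
  ring

/-- On a good path the drift of `X` is integrable on every `[0, t]`. [folklore] -/
theorem integrableOn_igXDrift (h : GoodPath κ ρ O W W' J ω) (hreg : RegularPair κ ρ W W' J)
    (hz : 0 < z.im) (t : ℝ≥0) :
    IntegrableOn (fun s : ℝ ↦ igXDrift ρ W' J z n s.toNNReal ω) (Icc 0 t) := by
  refine integrableOn_trunc ?_
  have h1 : IntegrableOn (fun s : ℝ ↦ 2 * igX W' J z n s.toNNReal ω / igQ W' J z n s.toNNReal ω) (Icc 0 t) := by
    have hprog : IsStronglyProgressive brownianFiltration
        fun s ω ↦ 2 * igX W' J z n s ω / igQ W' J z n s ω := by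
      simpa [div_eq_mul_inv] using
        ((isStronglyProgressive_const _ (2 : ℝ)).mul (isStronglyProgressive_igX hreg hz n)).mul
          (isStronglyProgressive_inv_igQ hreg hz n)
    have hm := measurable_path_of_isStronglyProgressive hprog ω
    exact (intervalIntegrable_iff_integrableOn_Icc_of_le t.coe_nonneg).1
      (intervalIntegrable_of_bdd hm (fun r ↦ abs_two_mul_igX_div_igQ_le' hz _ _) 0 t)
  exact h1.sub ((h.integrableOn t).const_mul ρ)

/-- On a good path the drift of `Z'` is integrable on every `[0, t]`. [folklore] -/
theorem integrableOn_igZpDrift (h : GoodPath κ ρ O W W' J ω) (t : ℝ≥0) :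
    IntegrableOn (fun s : ℝ ↦ igZpDrift ρ W' J z n s.toNNReal ω) (Icc 0 t) :=
  integrableOn_trunc ((h.integrableOn t).const_mul _)

end GoodPath

/-! ### `X` and `Z'` are Itô processes -/

section Ito

variable {κ : ℝ≥0} {ρ : ℝ} {O W W' J : ℝ≥0 → (ℝ≥0 → ℝ) → ℝ} {z : ℂ} {n : ℕ}

/-- **The Itô integral of the truncated constant `𝟙_{s≤ρₙ} c` is `c B^{ρₙ}`** a.s. at all times
(square-integrable integral of a bounded progressive integrand, identified by
`IsItoIntegral.ae_eq_stoppedProcess`, Revuz–Yor IV (2.5)); it is a martingale.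
[cite: RevuzYor1999, Ch. IV Prop. (2.5) and Prop. (2.10)(ii)] -/
theorem exists_isItoIntegral_trunc_const (h : RegularPair κ ρ W W' J) (hz : 0 < z.im) (n : ℕ) (c : ℝ) :
    ∃ K : ℝ≥0 → (ℝ≥0 → ℝ) → ℝ,
      IsItoIntegral (trunc (igLocTime W' J z n) fun _ _ ↦ c) brownian K brownianFiltration preWienerMeasure ∧
      Martingale K brownianFiltration preWienerMeasure ∧
      ∀ᵐ ω ∂preWienerMeasure, ∀ t : ℝ≥0,
        K t ω = c * brownian ((min (t : WithTop ℝ≥0) (igLocTime W' J z n ω)).untopA) ω := by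
  haveI := isProbabilityMeasure_preWienerMeasure'
  have hopt := isOptionalTime_igLocTime h hz n
  have hσ : IsStronglyProgressive brownianFiltration (trunc (igLocTime W' J z n) fun _ _ ↦ c) :=
    isStronglyProgressive_trunc (isStronglyProgressive_const _ _) hopt
  obtain ⟨K, hK, hKM, -⟩ := exists_isItoIntegral_of_abs_le hσ (C := |c|) fun t ω ↦ by
    rw [trunc_apply]; split_ifs
    · exact le_rfl
    · rw [abs_zero]; exact abs_nonneg _
  have hKeq := IsItoIntegral.ae_eq_stoppedProcess martingale_brownian_holds
    martingale_brownian_sq_sub_holds memLp_two_brownian continuous_brownian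
    (H := fun (_ : ℝ≥0) (_ : ℝ≥0 → ℝ) ↦ c) measurable_const hopt
    (isItoIntegral_const_brownian c) hK
  refine ⟨K, hK, hKM, ?_⟩
  filter_upwards [hKeq] with ω hω t
  rw [hω t]
  rfl

/-- **`X` is an Itô process**: `X = x^{ρₙ}` (clamped, progressive) is an Itô process driven by
the canonical Brownian motion for the raw filtration, with drift `𝟙_{s≤ρₙ}(2X/Q - ρJ)` and
diffusion coefficient `𝟙_{s≤ρₙ}(-√κ)`: almost surely (good paths) this is the integrated equation
`GoodPath.igX_eq_integral`, the stochastic term being the Itô integral `-√κ B^{ρₙ}` of the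
truncated constant. [cite: MillerSheffield2016, Thm. 2.4 (proof)] -/
theorem isItoProcess_igX (h : RegularPair κ ρ W W' J)
    (hgood : ∀ᵐ ω ∂preWienerMeasure, GoodPath κ ρ O W W' J ω) (hz : 0 < z.im) (n : ℕ) :
    IsItoProcess (igX W' J z n) (igXDrift ρ W' J z n) (igDiffusion κ W' J z n)
      brownian brownianFiltration preWienerMeasure := by
  obtain ⟨K, hK, -, hKeq⟩ := exists_isItoIntegral_trunc_const h hz n (-Real.sqrt κ)
  refine ⟨?_, K, hK, ?_⟩
  · filter_upwards [hgood] with ω hω t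
    exact hω.integrableOn_igXDrift h hz t
  · filter_upwards [hgood, hKeq] with ω hω hKω t
    rw [hKω t, igX_zero hz h.apply_zero, hω.igX_eq_integral hz t]
    simp only [timeIntegral]
    ring

/-- **`Z'` is an Itô process**: `Zp = (Z')^{ρₙ}` (clamped, progressive) is an Itô process with
drift `𝟙_{s≤ρₙ}(ρ+2)J` and diffusion coefficient `𝟙_{s≤ρₙ}√κ` (`dZ = (ρ+2) dt/Z + √κ dB` of
[LSW] §8.3, integrated on good paths: `GoodPath.igZp_eq_integral`). [cite: LawlerSchrammWerner2003Restriction, §8.3 (p. 36)] -/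
theorem isItoProcess_igZp (h : RegularPair κ ρ W W' J)
    (hgood : ∀ᵐ ω ∂preWienerMeasure, GoodPath κ ρ O W W' J ω) (hz : 0 < z.im) (n : ℕ) :
    IsItoProcess (igZp W' J z n) (igZpDrift ρ W' J z n) (igZpDiffusion κ W' J z n)
      brownian brownianFiltration preWienerMeasure := by
  obtain ⟨K, hK, -, hKeq⟩ := exists_isItoIntegral_trunc_const h hz n (Real.sqrt κ)
  refine ⟨?_, K, hK, ?_⟩
  · filter_upwards [hgood] with ω hω t
    exact hω.integrableOn_igZpDrift t
  · filter_upwards [hgood, hKeq] with ω hω hKω t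
    have hclock0 : ((min ((0 : ℝ≥0) : WithTop ℝ≥0) (igLocTime W' J z n ω)).untopA : ℝ≥0) = 0 := by
      rw [min_eq_left (show ((0 : ℝ≥0) : WithTop ℝ≥0) ≤ igLocTime W' J z n ω from bot_le)]; rfl
    have h0 : igZp W' J z n 0 ω = 0 := by
      rw [hω.igZp_eq_integral h 0, timeIntegral_apply_zero, hclock0, brownian_zero]
      simp
    rw [hKω t, h0, hω.igZp_eq_integral h t]
    simp only [timeIntegral]
    ring

end Ito

end SLEKappaRho

end Literature.Probability.RandomPlanarGeometry
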